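import Mathlib
import HarnessLib
import Literature.Barriers.CriticalPhenomena.RigorousRGSmallParameterGaussianFactorisation
import Literature.MathematicalPhysics.StatisticalMechanics.ScalarFieldGaussian
import Literature.MathematicalPhysics.StatisticalMechanics.WeightIntegrationMapABKM
import Literature.MathematicalPhysics.StatisticalMechanics.TorusNeighbourhoods

/-!
# Factorisation of Gaussian expectations of shift-invariant local functionals over separated
# regions — the finite-range property on the torus ([ABKM19] (6.38), Lemma 6.4 (5))

The fluctuation covariances `𝒞_{k+1}` of the finite-range decomposition on the TORUS are not
compactly supported: being translation invariant with `Σ_x 𝒞(x) = 0` (mean-zero fields), they are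
CONSTANT, `𝒞(x) = −C_k ≤ 0`, beyond the range `L^k/2` ([ABKM19] (6.23), `TorusFRD` clause (iii)).
Independence of the field over separated regions therefore holds only for SHIFT-INVARIANT
functionals (functionals of the gradient, Lemma 6.3) — which is how [ABKM19] use it in (6.38):
`∫ Φ(X₁ ∪ X₂, φ, ξ) μ_{k+1}(dξ) = ∫ Φ(X₁) μ_{k+1} · ∫ Φ(X₂) μ_{k+1}` when `dist(X₁*, X₂*)` exceeds the
range.

Proof formalised here: with `c = −m ≥ 0` the covariance `C⁰ = C + c·𝟙𝟙ᵀ` IS supported within the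
range and positive semidefinite; `P_{C⁰} = P_C ∗ P_{c𝟙𝟙ᵀ}` and under `P_{c𝟙𝟙ᵀ}` the field is almost
surely constant, so shift-invariant functionals have the same law under `P_C` and `P_{C⁰}`
(`integral_fieldGaussian_add_constMat`); under `P_{C⁰}` uncorrelated Gaussian restrictions are
independent (the tree's `LongRangePhi4.indepFun_restrict_fieldGaussian`, [BS15-I] §2.11), whence
the factorisation for `𝕜`-valued (`ℝ` or `ℂ`) functionals (`integral_mul_eq_of_local_shiftInvariant`),
and its torus form for the step measure `μ_{k+1} = N(0, circulant 𝒞)` of the renormalisation step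
(`integral_stepMeasure_mul_eq`: kernel even? not needed — `Σ 𝒞 = 0`, `𝒞 ⪰ 0` on mean-zero
fields, `𝒞 = m` on `{|x|_∞ ≥ r}`, regions `D₁, D₂` at `ℓ^∞`-distance `≥ r`).

* `constMat c`, `posSemidef_constMat`, `ae_eval_eq_eval_fieldGaussian_constMat`;
* `integral_conv_eq_of_ae_invariant` (generic: `∫ F d(μ ∗ ν) = ∫ F dμ` when `ν`-a.e. translate fixes `F`);
* `integral_fieldGaussian_add_constMat` — shift-invariant `F`: `E_{C + c𝟙𝟙ᵀ}[F] = E_C[F]`;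
* `integral_mul_eq_mul_integral_of_dependsOn'` — the tree's factorisation lemma for `𝕜`-valued
  functionals (`IndepFun.integral_fun_comp_mul_comp`);
* **`integral_mul_eq_of_local_shiftInvariant`** — `E_C[FG] = E_C[F] E_C[G]` for value-local,
  shift-invariant `F ∈ 𝒩(D₁)`, `G ∈ 𝒩(D₂)` when `C = −c` on `D₁ × D₂`, `c ≥ 0`;
* `posSemidef_circulant_of_sum_eq_zero`, **`integral_stepMeasure_mul_eq`** — the torus version for
  `stepMeasure 𝒞`.

Everything is proved; no named fact.  (The a.s.-constancy argument and the convolution lemma are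
the Literature copies of the same steps carried out for the zero mode `P_0` in the route file
`Summits/…/ComplexGFFStiffnessHypACumulantGreenMeasure.lean`, which Literature cannot import.)

## References
* S. Adams, S. Buchholz, R. Kotecký, S. Müller, arXiv:1910.13564, Ch. 6.1 (6.23) (`𝒞_k = −C_k`
  beyond the range), Lemma 6.3 (shift invariance), proof of Lemma 6.4 (5), (6.37)–(6.38)
  [AdamsBuchholzKoteckyMuller2019].
* D. C. Brydges, G. Slade, *A renormalisation group method. I*, J. Stat. Phys. 159 (2015),
  §2.11 (factorisation property of the expectation) [BrydgesSlade2015RGI].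
-/

noncomputable section

namespace Literature.MathematicalPhysics.StatisticalMechanics.GradientRG

open scoped BigOperators Matrix
open MeasureTheory ProbabilityTheory Finset
open Literature.Barriers.CriticalPhenomena.LongRangePhi4 (fieldGaussian fieldGaussian_add
  integral_eval_mul_eval_fieldGaussian indepFun_restrict_fieldGaussian extendField
  measurable_extendField)

section General

variable {Λ : Type*} [Fintype Λ] [DecidableEq Λ] {𝕜 : Type*} [RCLike 𝕜]

/-! ## The constant covariance `c·𝟙𝟙ᵀ`: almost surely constant fields -/

/-- The rank-one covariance `c·𝟙𝟙ᵀ` of a random constant field.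
[cite: AdamsBuchholzKoteckyMuller2019, Ch. 6.1 (6.23)] -/
def constMat (c : ℝ) : Matrix Λ Λ ℝ := Matrix.of fun _ _ => c

omit [DecidableEq Λ] in
/-- `c·𝟙𝟙ᵀ ⪰ 0` for `c ≥ 0`. [cite: AdamsBuchholzKoteckyMuller2019, Ch. 6.1 (6.23)] -/
theorem posSemidef_constMat {c : ℝ} (hc : 0 ≤ c) : (constMat (Λ := Λ) c).PosSemidef := by
  refine Matrix.PosSemidef.of_dotProduct_mulVec_nonneg
    (Matrix.IsHermitian.ext fun _ _ => by simp [constMat]) fun x => ?_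
  rw [star_trivial]
  have h1 : constMat c *ᵥ x = fun _ => c * ∑ j, x j := by
    funext i; simp [Matrix.mulVec, dotProduct, constMat, Finset.mul_sum]
  have h : x ⬝ᵥ (constMat c *ᵥ x) = c * (∑ i, x i) ^ 2 := by
    rw [h1, dotProduct, ← Finset.sum_mul, sq]; ring
  rw [h]
  exact mul_nonneg hc (sq_nonneg _)

/-- Evaluations are square integrable under `P_C`. [cite: BrydgesSlade2015RGI, §2.11] -/
theorem memLp_two_eval_fieldGaussian' {m : ℕ} (C : Matrix Λ Λ ℝ) (x : Λ) (i : Fin m) :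
    MemLp (fun φ : Λ → Fin m → ℝ => φ x i) 2 (fieldGaussian Λ C m) := by
  have hmeas : Measurable (fun φ : Λ → Fin m → ℝ => φ x i) :=
    (measurable_pi_apply i).comp (measurable_pi_apply x)
  rw [fieldGaussian, memLp_map_measure_iff hmeas.aestronglyMeasurable
    (Literature.Barriers.CriticalPhenomena.LongRangePhi4.fieldEquiv Λ m).measurable.aemeasurable]
  have h := IsGaussian.memLp_dual (multivariateGaussian (0 : EuclideanSpace ℝ (Λ × Fin m))
    (Literature.Barriers.CriticalPhenomena.LongRangePhi4.componentMatrix C m))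
    (EuclideanSpace.proj (𝕜 := ℝ) (x, i)) 2 (by simp)
  simpa [EuclideanSpace.coe_proj, Function.comp_def] using h

/-- **Under `P_{c𝟙𝟙ᵀ}` the field is almost surely constant** (`c ≥ 0`): the increments have second
moment `c − 2c + c = 0`. [cite: AdamsBuchholzKoteckyMuller2019, Ch. 6.1 (6.23)] -/
theorem ae_eval_eq_eval_fieldGaussian_constMat {c : ℝ} (hc : 0 ≤ c) :
    ∀ᵐ ψ ∂(fieldGaussian Λ (constMat c) 1), ∀ x y : Λ, ψ x 0 = ψ y 0 := by
  classical
  set μ := fieldGaussian Λ (constMat c) 1 with hμ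
  have hmem : ∀ z : Λ, MemLp (fun ψ : Λ → Fin 1 → ℝ => ψ z 0) 2 μ :=
    fun z => memLp_two_eval_fieldGaussian' _ z 0
  have hint : ∀ z w : Λ, Integrable (fun ψ : Λ → Fin 1 → ℝ => ψ z 0 * ψ w 0) μ :=
    fun z w => (hmem z).integrable_mul (hmem w)
  have hcov : ∀ z w : Λ, ∫ ψ, ψ z 0 * ψ w 0 ∂μ = c := fun z w => by
    rw [hμ, integral_eval_mul_eval_fieldGaussian (posSemidef_constMat hc)]
    simp [constMat]
  haveI : Finite Λ := inferInstance
  rcases isEmpty_or_nonempty Λ with hΛ | hΛ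
  · exact Filter.Eventually.of_forall fun ψ x => (IsEmpty.false x).elim
  refine ae_all_iff.2 fun x => ae_all_iff.2 fun y => ?_
  have hsq : Integrable (fun ψ : Λ → Fin 1 → ℝ => (ψ x 0 - ψ y 0) ^ 2) μ := by
    have h := ((hmem x).sub (hmem y)).integrable_sq
    simpa using h
  have h0 : ∫ ψ, (ψ x 0 - ψ y 0) ^ 2 ∂μ = 0 := by
    have hexp : (fun ψ : Λ → Fin 1 → ℝ => (ψ x 0 - ψ y 0) ^ 2) =
        fun ψ => (ψ x 0 * ψ x 0 - 2 * (ψ x 0 * ψ y 0)) + ψ y 0 * ψ y 0 := by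
      funext ψ; ring
    have h2 : Integrable (fun ψ : Λ → Fin 1 → ℝ => 2 * (ψ x 0 * ψ y 0)) μ := (hint x y).const_mul 2
    have h12 : Integrable (fun ψ : Λ → Fin 1 → ℝ => ψ x 0 * ψ x 0 - 2 * (ψ x 0 * ψ y 0)) μ :=
      (hint x x).sub h2
    rw [hexp, integral_add h12 (hint y y), integral_sub (hint x x) h2, integral_const_mul, hcov, hcov,
      hcov]
    ring
  have hae := (integral_eq_zero_iff_of_nonneg (fun ψ => sq_nonneg _) hsq).1 h0
  filter_upwards [hae] with ψ hψ
  have : (ψ x 0 - ψ y 0) ^ 2 = 0 := hψ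
  exact sub_eq_zero.1 (pow_eq_zero_iff two_ne_zero |>.1 this)

/-! ## Shift-invariant functionals do not see the constant covariance -/

/-- **Convolution with a measure whose translates leave `F` a.e. invariant**: if `ν` is a
probability measure and for `ν`-a.e. `y` the translate `F(· + y)` equals `F`, then
`∫ F d(μ ∗ ν) = ∫ F dμ`. [cite: BrydgesSlade2015RGI, §2.11] -/
theorem integral_conv_eq_of_ae_invariant {X : Type*} [AddCommGroup X] [MeasurableSpace X]
    [MeasurableAdd₂ X] {E : Type*} [NormedAddCommGroup E] [NormedSpace ℝ E]
    {μ ν : Measure X} [SFinite μ] [SFinite ν] [IsProbabilityMeasure ν] {F : X → E}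
    (hF : StronglyMeasurable F) (hinv : ∀ᵐ y ∂ν, ∀ x, F (x + y) = F x) :
    ∫ z, F z ∂(μ ∗ ν) = ∫ x, F x ∂μ := by
  rw [Measure.conv, integral_map (by fun_prop) hF.aestronglyMeasurable]
  have hae : (fun p : X × X => F (p.1 + p.2)) =ᵐ[μ.prod ν] fun p => F p.1 := by
    have h := (Measure.quasiMeasurePreserving_snd (μ := μ) (ν := ν)).ae hinv
    filter_upwards [h] with p hp using hp p.1
  rw [integral_congr_ae hae, ← integral_map (f := fun x : X => F x) measurable_fst.aemeasurable
    hF.aestronglyMeasurable, Measure.map_fst_prod, measure_univ, one_smul]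

/-- **Shift-invariant functionals have the same expectation under `P_C` and `P_{C + c𝟙𝟙ᵀ}`**
(`C ⪰ 0`, `c ≥ 0`): for strongly measurable `F` on scalar fields with `F(φ + const) = F(φ)`,
`∫ F(x ↦ φ x 0) dP_{C + c𝟙𝟙ᵀ} = ∫ F(x ↦ φ x 0) dP_C`.
[cite: AdamsBuchholzKoteckyMuller2019, Lemma 6.3] -/
theorem integral_fieldGaussian_add_constMat {E : Type*} [NormedAddCommGroup E] [NormedSpace ℝ E]
    {C : Matrix Λ Λ ℝ} (hC : C.PosSemidef) {c : ℝ} (hc : 0 ≤ c) {F : (Λ → ℝ) → E}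
    (hF : StronglyMeasurable F) (hinv : ∀ (φ : Λ → ℝ) (a : ℝ), F (φ + fun _ => a) = F φ) :
    ∫ φ, F (fun x => φ x 0) ∂(fieldGaussian Λ (C + constMat c) 1) =
      ∫ φ, F (fun x => φ x 0) ∂(fieldGaussian Λ C 1) := by
  rw [fieldGaussian_add hC (posSemidef_constMat hc)]
  have hsq : Measurable (fun φ : Λ → Fin 1 → ℝ => fun x => φ x 0) :=
    measurable_pi_lambda _ fun x => (measurable_pi_apply 0).comp (measurable_pi_apply x)
  refine integral_conv_eq_of_ae_invariant (hF.comp_measurable hsq) ?_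
  rcases isEmpty_or_nonempty Λ with hΛ | ⟨⟨x₀⟩⟩
  · exact Filter.Eventually.of_forall fun ψ φ => by
      congr 1; funext x; exact (IsEmpty.false x).elim
  filter_upwards [ae_eval_eq_eval_fieldGaussian_constMat (Λ := Λ) hc] with ψ hψ φ
  have hcst : (fun x => (φ + ψ) x 0) = (fun x => φ x 0) + fun _ => ψ x₀ 0 := by
    funext x
    simp only [Pi.add_apply]
    rw [hψ x x₀]
  rw [hcst, hinv]

/-! ## Factorisation -/

omit [Fintype Λ] in
/-- A functional depending only on the field in `D` factors through the restriction to `D`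
(any codomain). [cite: BrydgesSlade2015RGI, §2.11] -/
theorem eq_comp_restrict_of_dependsOn' {n : ℕ} {β : Type*} {D : Finset Λ} {F : (Λ → Fin n → ℝ) → β}
    (hF : ∀ φ ψ : Λ → Fin n → ℝ, (∀ x ∈ D, φ x = ψ x) → F φ = F ψ) (ζ : Λ → Fin n → ℝ) :
    F ζ = F (extendField D (fun p : ↥D × Fin n => ζ p.1.1 p.2)) := by
  classical
  refine hF _ _ fun x hx => ?_
  funext k
  simp [extendField, hx]

/-- **Factorisation of the Gaussian expectation for `𝕜`-valued functionals** (`𝕜 = ℝ` or `ℂ`):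
`E_C(FG) = (E_C F)(E_C G)` for measurable `F ∈ 𝒩(D₁)`, `G ∈ 𝒩(D₂)` when `C_{xy} = 0` for
`x ∈ D₁`, `y ∈ D₂` (uncorrelated jointly Gaussian restrictions are independent).
[cite: BrydgesSlade2015RGI, §2.11] -/
theorem integral_mul_eq_mul_integral_of_dependsOn' {n : ℕ} {C : Matrix Λ Λ ℝ} (hC : C.PosSemidef)
    {D₁ D₂ : Finset Λ} (h0 : ∀ x ∈ D₁, ∀ y ∈ D₂, C x y = 0) {F G : (Λ → Fin n → ℝ) → 𝕜}
    (hF : ∀ φ ψ : Λ → Fin n → ℝ, (∀ x ∈ D₁, φ x = ψ x) → F φ = F ψ)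
    (hG : ∀ φ ψ : Λ → Fin n → ℝ, (∀ x ∈ D₂, φ x = ψ x) → G φ = G ψ)
    (mF : Measurable F) (mG : Measurable G) :
    ∫ ζ, F ζ * G ζ ∂(fieldGaussian Λ C n) =
      (∫ ζ, F ζ ∂(fieldGaussian Λ C n)) * ∫ ζ, G ζ ∂(fieldGaussian Λ C n) := by
  have hind := indepFun_restrict_fieldGaussian (n := n) hC h0
  set f : (↥D₁ × Fin n → ℝ) → 𝕜 := fun u => F (extendField D₁ u) with hf
  set g : (↥D₂ × Fin n → ℝ) → 𝕜 := fun u => G (extendField D₂ u) with hg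
  have hFf : ∀ ζ, F ζ = f (fun p : ↥D₁ × Fin n => ζ p.1.1 p.2) := fun ζ => eq_comp_restrict_of_dependsOn' hF ζ
  have hGg : ∀ ζ, G ζ = g (fun q : ↥D₂ × Fin n => ζ q.1.1 q.2) := fun ζ => eq_comp_restrict_of_dependsOn' hG ζ
  have mf : Measurable f := mF.comp (measurable_extendField D₁)
  have mg : Measurable g := mG.comp (measurable_extendField D₂)
  have mX : Measurable fun (ζ : Λ → Fin n → ℝ) (p : ↥D₁ × Fin n) => ζ p.1.1 p.2 :=
    measurable_pi_lambda _ fun p => (measurable_pi_apply p.2).comp (measurable_pi_apply p.1.1)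
  have mY : Measurable fun (ζ : Λ → Fin n → ℝ) (q : ↥D₂ × Fin n) => ζ q.1.1 q.2 :=
    measurable_pi_lambda _ fun q => (measurable_pi_apply q.2).comp (measurable_pi_apply q.1.1)
  simp_rw [hFf, hGg]
  exact hind.integral_fun_comp_mul_comp mX.aemeasurable mY.aemeasurable mf.aestronglyMeasurable
    mg.aestronglyMeasurable

/-- **Factorisation for shift-invariant local functionals under a covariance that is CONSTANT
(`= −c ≤ 0`) across the regions** ([ABKM19] (6.38)): `E_C(FG) = (E_C F)(E_C G)` for measurable,
shift-invariant `F ∈ 𝒩(D₁)`, `G ∈ 𝒩(D₂)` (scalar fields) when `C ⪰ 0` and `C_{xy} = −c` for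
`x ∈ D₁`, `y ∈ D₂`. [cite: AdamsBuchholzKoteckyMuller2019, Lemma 6.4 (5) (6.38)] -/
theorem integral_mul_eq_of_local_shiftInvariant {C : Matrix Λ Λ ℝ} (hC : C.PosSemidef) {c : ℝ}
    (hc : 0 ≤ c) {D₁ D₂ : Finset Λ} (h0 : ∀ x ∈ D₁, ∀ y ∈ D₂, C x y = -c)
    {F G : (Λ → ℝ) → 𝕜}
    (hF : ∀ φ ψ : Λ → ℝ, (∀ x ∈ D₁, φ x = ψ x) → F φ = F ψ)
    (hG : ∀ φ ψ : Λ → ℝ, (∀ x ∈ D₂, φ x = ψ x) → G φ = G ψ)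
    (hFs : ∀ (φ : Λ → ℝ) (a : ℝ), F (φ + fun _ => a) = F φ)
    (hGs : ∀ (φ : Λ → ℝ) (a : ℝ), G (φ + fun _ => a) = G φ)
    (mF : Measurable F) (mG : Measurable G) :
    ∫ φ, F (fun x => φ x 0) * G (fun x => φ x 0) ∂(fieldGaussian Λ C 1) =
      (∫ φ, F (fun x => φ x 0) ∂(fieldGaussian Λ C 1)) *
        ∫ φ, G (fun x => φ x 0) ∂(fieldGaussian Λ C 1) := by
  -- pass to `C⁰ = C + c𝟙𝟙ᵀ`, supported away from `D₁ × D₂`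
  have hFG : StronglyMeasurable fun φ : Λ → ℝ => F φ * G φ := (mF.mul mG).stronglyMeasurable
  rw [← integral_fieldGaussian_add_constMat hC hc hFG (fun φ a => by
      simp only [hFs, hGs]),
    ← integral_fieldGaussian_add_constMat hC hc mF.stronglyMeasurable hFs,
    ← integral_fieldGaussian_add_constMat hC hc mG.stronglyMeasurable hGs]
  have hsq : Measurable (fun φ : Λ → Fin 1 → ℝ => fun x => φ x 0) :=
    measurable_pi_lambda _ fun x => (measurable_pi_apply 0).comp (measurable_pi_apply x)
  refine integral_mul_eq_mul_integral_of_dependsOn' (hC.add (posSemidef_constMat hc))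
    (D₁ := D₁) (D₂ := D₂) ?_
    (F := fun φ => F fun x => φ x 0) (G := fun φ => G fun x => φ x 0) ?_ ?_
    (mF.comp hsq) (mG.comp hsq)
  · intro x hx y hy
    rw [Matrix.add_apply, h0 x hx y hy]; simp [constMat]
  · intro φ ψ h; exact hF _ _ fun x hx => by simp only [h x hx]
  · intro φ ψ h; exact hG _ _ fun x hx => by simp only [h x hx]

end General

/-! ## The torus: the step measure `N(0, circulant 𝒞)` of the renormalisation step -/

section Torus

open Literature.MathematicalPhysics.StatisticalMechanics.GradientFRD (supNorm)

variable {d M : ℕ} [NeZero M] {𝕜 : Type*} [RCLike 𝕜]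

/-- A zero-sum kernel's convolution operator kills constants (general dimension; the route file
`…GreenSplit` has the `d = 4` case). [cite: AdamsBuchholzKoteckyMuller2019, Theorem 6.1 (i)] -/
theorem circulant_mulVec_const' {𝒞 : (Fin d → ZMod M) → ℝ} (h0 : ∑ x, 𝒞 x = 0) (c : ℝ) :
    Matrix.circulant 𝒞 *ᵥ (fun _ : Fin d → ZMod M => c) = 0 := by
  funext x
  simp only [Matrix.mulVec, dotProduct, Matrix.circulant_apply, Pi.zero_apply, ← Finset.sum_mul]
  rw [show ∑ y : Fin d → ZMod M, 𝒞 (x - y) = ∑ y : Fin d → ZMod M, 𝒞 y from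
    (Equiv.subLeft x).sum_comp 𝒞, h0, zero_mul]

/-- The range of a zero-sum kernel's convolution operator is mean-zero.
[cite: AdamsBuchholzKoteckyMuller2019, Theorem 6.1 (i)] -/
theorem sum_circulant_mulVec' {𝒞 : (Fin d → ZMod M) → ℝ} (h0 : ∑ x, 𝒞 x = 0)
    (v : (Fin d → ZMod M) → ℝ) : ∑ x, (Matrix.circulant 𝒞 *ᵥ v) x = 0 := by
  simp only [Matrix.mulVec, dotProduct, Matrix.circulant_apply]
  rw [Finset.sum_comm]
  refine Finset.sum_eq_zero fun y _ => ?_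
  rw [← Finset.sum_mul, show ∑ x : Fin d → ZMod M, 𝒞 (x - y) = ∑ x : Fin d → ZMod M, 𝒞 x from
    (Equiv.subRight y).sum_comp 𝒞, h0, zero_mul]

/-- **A translation-invariant even kernel with `Σ_x 𝒞(x) = 0` that is positive on mean-zero fields
is positive semidefinite on all fields** (the constant mode lies in the kernel of `circulant 𝒞`):
clauses (o) and (i) of the torus finite-range decomposition (`GradientFRD.TorusFRD`).
[cite: AdamsBuchholzKoteckyMuller2019, Theorem 6.1 (i)] -/
theorem posSemidef_circulant_of_sum_eq_zero {𝒞 : (Fin d → ZMod M) → ℝ} (h0 : ∑ x, 𝒞 x = 0)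
    (heven : ∀ x, 𝒞 (-x) = 𝒞 x)
    (hpos : ∀ φ : (Fin d → ZMod M) → ℝ, ∑ x, φ x = 0 → 0 ≤ ∑ x, ∑ y, φ x * 𝒞 (x - y) * φ y) :
    (Matrix.circulant 𝒞).PosSemidef := by
  have hsymm : (Matrix.circulant 𝒞).IsHermitian := by
    unfold Matrix.IsHermitian
    rw [Matrix.conjTranspose_eq_transpose_of_trivial, Matrix.transpose_circulant]
    exact congrArg Matrix.circulant (funext heven)
  refine Matrix.PosSemidef.of_dotProduct_mulVec_nonneg hsymm fun v => ?_
  rw [star_trivial]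
  set N : ℝ := (Fintype.card (Fin d → ZMod M) : ℝ) with hN
  have hN0 : N ≠ 0 := by rw [hN]; exact_mod_cast Fintype.card_ne_zero
  set c : ℝ := (∑ x, v x) / N with hc
  set w : (Fin d → ZMod M) → ℝ := v - fun _ => c with hw
  have hw0 : ∑ x, w x = 0 := by
    simp only [hw, Pi.sub_apply, Finset.sum_sub_distrib, Finset.sum_const, Finset.card_univ,
      nsmul_eq_mul]
    rw [hc]; field_simp; ring
  have hv : v = w + fun _ => c := by rw [hw, sub_add_cancel]
  have hMv : Matrix.circulant 𝒞 *ᵥ v = Matrix.circulant 𝒞 *ᵥ w := by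
    rw [hv, Matrix.mulVec_add, circulant_mulVec_const' h0, add_zero]
  have hsum : (fun _ : Fin d → ZMod M => c) ⬝ᵥ (Matrix.circulant 𝒞 *ᵥ w) = 0 := by
    simp only [dotProduct, ← Finset.mul_sum, sum_circulant_mulVec' h0 w, mul_zero]
  have hform : w ⬝ᵥ (Matrix.circulant 𝒞 *ᵥ w) = ∑ x, ∑ y, w x * 𝒞 (x - y) * w y := by
    simp only [dotProduct, Matrix.mulVec, Matrix.circulant_apply, Finset.mul_sum, mul_assoc]
  rw [hMv, hv, add_dotProduct, hsum, add_zero, hform]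
  exact hpos w hw0

/-- Change of variables for the step measure, measurable integrands: `∫ F dμ_{k+1}` equals the
integral of `F(x ↦ φ x 0)` against the one-component field Gaussian `P_{circulant 𝒞}` of the
tree's Gaussian library. [cite: AdamsBuchholzKoteckyMuller2019, Ch. 4 (4.2)] -/
theorem integral_stepMeasure_eq_fieldGaussian {𝒞 : (Fin d → ZMod M) → ℝ}
    (hC : (Matrix.circulant 𝒞).PosSemidef) {E : Type*} [NormedAddCommGroup E] [NormedSpace ℝ E]
    {F : ((Fin d → ZMod M) → ℝ) → E} (hF : AEStronglyMeasurable F (stepMeasure 𝒞)) :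
    ∫ ξ, F ξ ∂(stepMeasure 𝒞) =
      ∫ φ, F (fun x => φ x 0) ∂(fieldGaussian (Fin d → ZMod M) (Matrix.circulant 𝒞) 1) := by
  rw [Literature.MathematicalPhysics.StatisticalMechanics.GradientRG.integral_fieldGaussian_one hC]
  rw [stepMeasure] at hF ⊢
  rw [integral_map (PiLp.continuous_ofLp 2 _).measurable.aemeasurable hF]

/-- **Finite-range factorisation for the step measure** ([ABKM19] (6.38)): let `𝒞` be an even
kernel on `(ℤ/M)^d` with `Σ 𝒞 = 0`, positive on mean-zero fields, and CONSTANT `= m` on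
`{|x|_∞ ≥ r}` (clauses (o), (i), (iii) of `GradientFRD.TorusFRD`, `m ≤ 0`).  If `F ∈ 𝒩(D₁)`,
`G ∈ 𝒩(D₂)` are measurable, shift invariant, and `dist_∞(D₁, D₂) ≥ r`, then
`∫ F G dμ = ∫ F dμ · ∫ G dμ` for `μ = stepMeasure 𝒞 = N(0, circulant 𝒞)`.
[cite: AdamsBuchholzKoteckyMuller2019, Lemma 6.4 (5) (6.38)] -/
theorem integral_stepMeasure_mul_eq {𝒞 : (Fin d → ZMod M) → ℝ} (h0 : ∑ x, 𝒞 x = 0)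
    (heven : ∀ x, 𝒞 (-x) = 𝒞 x)
    (hpos : ∀ φ : (Fin d → ZMod M) → ℝ, ∑ x, φ x = 0 → 0 ≤ ∑ x, ∑ y, φ x * 𝒞 (x - y) * φ y)
    {m : ℝ} (hm : m ≤ 0) {r : ℕ} (hrange : ∀ x, r ≤ supNorm x → 𝒞 x = m)
    {D₁ D₂ : Finset (Fin d → ZMod M)} (hsep : TorusPolymer.Separated r D₁ D₂)
    {F G : ((Fin d → ZMod M) → ℝ) → 𝕜}
    (hF : ∀ φ ψ : (Fin d → ZMod M) → ℝ, (∀ x ∈ D₁, φ x = ψ x) → F φ = F ψ)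
    (hG : ∀ φ ψ : (Fin d → ZMod M) → ℝ, (∀ x ∈ D₂, φ x = ψ x) → G φ = G ψ)
    (hFs : ∀ (φ : (Fin d → ZMod M) → ℝ) (a : ℝ), F (φ + fun _ => a) = F φ)
    (hGs : ∀ (φ : (Fin d → ZMod M) → ℝ) (a : ℝ), G (φ + fun _ => a) = G φ)
    (mF : Measurable F) (mG : Measurable G) :
    ∫ ξ, F ξ * G ξ ∂(stepMeasure 𝒞) = (∫ ξ, F ξ ∂(stepMeasure 𝒞)) * ∫ ξ, G ξ ∂(stepMeasure 𝒞) := by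
  have hC := posSemidef_circulant_of_sum_eq_zero h0 heven hpos
  have mFG : Measurable fun ξ : (Fin d → ZMod M) → ℝ => F ξ * G ξ := by fun_prop
  rw [integral_stepMeasure_eq_fieldGaussian hC (F := fun ξ => F ξ * G ξ) mFG.aestronglyMeasurable,
    integral_stepMeasure_eq_fieldGaussian hC mF.aestronglyMeasurable,
    integral_stepMeasure_eq_fieldGaussian hC mG.aestronglyMeasurable]
  refine integral_mul_eq_of_local_shiftInvariant hC (neg_nonneg.2 hm) (c := -m) ?_ hF hG hFs hGs mF mG
  intro x hx y hy
  rw [Matrix.circulant_apply, neg_neg]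
  exact hrange (x - y) (hsep x hx y hy)

end Torus

end Literature.MathematicalPhysics.StatisticalMechanics.GradientRG

end
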